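import Mathlib
import HarnessLib
import Summits.AtomisticToContinuum.FouriersLaw.Theses.JunctionLocality
import Summits.AtomisticToContinuum.FouriersLaw.Theorems.JunctionLocalitySuperadditiveResistanceStubPlainForwardField
import Summits.AtomisticToContinuum.FouriersLaw.Theorems.JunctionLocalityConductanceLowerBoundStubRowSum
import Summits.AtomisticToContinuum.FouriersLaw.Theorems.JunctionLocalityConductanceLowerBoundStubFisherSquare
import Summits.AtomisticToContinuum.FouriersLaw.Theorems.JunctionLocalityConductanceLowerBoundStubKuboLink
import Summits.AtomisticToContinuum.FouriersLaw.Theorems.FourierGreenKuboFourierFiniteResponseOfUnique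

/-!
# `ConductanceLowerBound` is EQUIVALENT to the transmission-gradient floor (crux stmt-AtomisticToContinuum-11749)

Helper file (`--supports stmt-AtomisticToContinuum-11749`) of the crux-plan lines `far-contact-fisher-square` /
`ForecastSensitivitySketch` (crux `JunctionLocality.ConductanceLowerBound`, the positivity half `liminf_N D_N > 0` of
Fourier's law for the pinned anharmonic chain).  With the three fixed-`N` identities of the trunk now ALL landed —

* Kubo link `D_L/(L−1) = γ(1 − (γ/T²)⟨g, k_0⟩_{μ_T})` (`stub_kuboLink`, p95958),
* energy row sum `⟨g, k_0⟩ + ⟨g, k_{L−1}⟩ = T²/γ` (`stub_rowSum`, p87148),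
* far-contact Fisher square `⟨g, k_{L−1}⟩ = 2γT‖∂_{p_{L−1}} g‖²` (`stub_fisherSquare`, p89790),

(`g` any classical mean-zero `C² ∩ L²(μ_T)` forward field of the LEFT bath of the `L`-chain, `k_b = p_b² − T`) — together with the
landed existence theorems (steady states: `pinnedChain_exists_isSteadyState`; weak-NESS uniqueness: `NessUnique_holds`; response
limits: `FourierGreenKubo.finiteResponse_of_unique`; forward fields: `stub_plainForwardField`) the crux becomes a statement about ONE
equilibrium Dirichlet energy:

* `response_eq_dirichlet` — along the crux's data, `D_L = (L−1)·(2γ³/T)·‖∂_{p_{L−1}} g‖²_{L²(μ_T)}` for EVERY left forward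
  field `g` and every `L ≥ 2` (so the right side does not depend on the choice of `g`, and `D_L ≥ 0`);
* `conductanceLowerBound_of_floor` — the TRANSMISSION-GRADIENT FLOOR (`∃ c > 0 ∃ L₁ ∀ L ≥ L₁, L ≥ 2, ∀ g`,
  `c ≤ (L−1)‖∂_{p_{L−1}} g‖²`) implies the crux (constant `2γ³c/T`);
* `floor_of_conductanceLowerBound` — conversely the crux implies the floor (constant `cT/(2γ³)`), by running the crux along the
  canonical steady-state family with its (existing) response coefficients;
* `conductanceLowerBound_iff_floor` — **`ConductanceLowerBound ↔ floor`**: the crux IS the statement that the equilibrium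
  injection potential of the hot contact keeps Dirichlet energy `≥ c/(L−1)` at the far contact, uniformly in `L` — a pure
  EQUILIBRIUM statement (Gibbs measure + Poisson field of `L_{T,T}`; no NESS, no uniqueness, no response limit in it).
* `response_nonneg` — corollary: `0 ≤ D_L` for every `L ≥ 2` along every unique steady family (the physical sign, cf.
  Disproof §2b).

No definitions (the floor is spelled out), no named facts, no sorry.
-/

noncomputable section

open MeasureTheory Filter Topology
open scoped ContDiff
open Literature.MathematicalPhysics.KineticTheory.HeatConduction
open Summit.AtomisticToContinuum.FouriersLaw.Theorems.SuperadditiveResistance.DeviceLiouville (kin)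
open Summit.AtomisticToContinuum.FouriersLaw.Cruxes.SuperadditiveResistance.FloatingProbeBypassLaplacian
  (stub_plainForwardField)
open Summit.AtomisticToContinuum.FouriersLaw.Theses.JunctionLocality (ConductanceLowerBound NessUnique_holds)

namespace Summit.AtomisticToContinuum.FouriersLaw.Cruxes.ConductanceLowerBound.ForecastSensitivity

/-! ## §1 The response coefficient is a Dirichlet energy -/

/-- **`D_L = (L−1)·(2γ³/T)·‖∂_{p_{L−1}} g‖²`** along the crux's data (weak-NESS uniqueness, a steady-state family `μ`, its
response coefficients `D` at `T > 0`), for every `L ≥ 2` and every classical mean-zero `C² ∩ L²(μ_T)` left forward field `g`: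
Kubo link ∘ row sum ∘ far-contact Fisher square. [cite: ReyBellet2003, Rem. 4.4] [cite: KunduDharNarayan2009, p. 3] -/
theorem response_eq_dirichlet
    {ω₂ lam β γ : ℝ} {μ : (N : ℕ) → ℝ → ℝ → Measure (PhaseSpace N)} {T : ℝ} {D : ℕ → ℝ}
    (hω : 0 < ω₂) (hl : 0 < lam) (hβ : 0 < β) (hγ : 0 < γ) (hT : 0 < T)
    (hU : ∀ (N : ℕ) (T_L T_R : ℝ), 0 < T_L → 0 < T_R → ∀ ρ ρ' : Measure (PhaseSpace N),
        (pinnedChain ω₂ lam β γ).IsSteadyState N T_L T_R ρ →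
        (pinnedChain ω₂ lam β γ).IsSteadyState N T_L T_R ρ' → ρ = ρ')
    (hμ : ∀ (N : ℕ) (T_L T_R : ℝ), 0 < T_L → 0 < T_R →
        (pinnedChain ω₂ lam β γ).IsSteadyState N T_L T_R (μ N T_L T_R))
    (hD : ∀ N : ℕ, Tendsto (fun δ : ℝ =>
        (pinnedChain ω₂ lam β γ).totalCurrent (μ N (T + δ / 2) (T - δ / 2)) / δ) (𝓝[≠] 0) (𝓝 (D N)))
    {L : ℕ} (hL2 : 2 ≤ L) {g : PhaseSpace L → ℝ} (hgC : ContDiff ℝ 2 g)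
    (hgL2 : MemLp g 2 ((pinnedChain ω₂ lam β γ).gibbsMeasure L T))
    (hg0 : ∫ x, g x ∂((pinnedChain ω₂ lam β γ).gibbsMeasure L T) = 0)
    (hgeq : ∀ x, (pinnedChain ω₂ lam β γ).generator L T T g x = -(kin L 0 x - T)) :
    D L = ((L : ℝ) - 1) * (2 * γ ^ 3 / T *
      ∫ x, (partialP (⟨L - 1, by omega⟩ : Fin L) g x) ^ 2 ∂((pinnedChain ω₂ lam β γ).gibbsMeasure L T)) := by
  set μT := (pinnedChain ω₂ lam β γ).gibbsMeasure L T with hμT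
  set A : ℝ := ∫ x, g x * (kin L 0 x - T) ∂μT with hA
  set B : ℝ := ∫ x, g x * (kin L (L - 1) x - T) ∂μT with hB'
  set E : ℝ := ∫ x, (partialP (⟨L - 1, by omega⟩ : Fin L) g x) ^ 2 ∂μT with hE
  have hkubo : D L / ((L : ℝ) - 1) = γ * (1 - γ / T ^ 2 * A) :=
    stub_kuboLink ω₂ lam β γ μ T D hω hl hβ hγ hT hU hμ hD L hL2 g hgC hgL2 hg0 hgeq
  have hrow : A + B = T ^ 2 / γ := stub_rowSum ω₂ lam β γ T hω hl hβ hγ hT L hL2 g hgC hgL2 hg0 hgeq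
  have hfis : B = 2 * γ * T * E := stub_fisherSquare ω₂ lam β γ T hω hl hβ hγ hT L hL2 g hgC hgL2 hg0 hgeq
  have hLpos : (0 : ℝ) < (L : ℝ) - 1 := by
    have : (2 : ℝ) ≤ L := by exact_mod_cast hL2
    linarith
  have hγ0 : γ ≠ 0 := hγ.ne'
  have hT0 : T ≠ 0 := hT.ne'
  have hDL : D L = ((L : ℝ) - 1) * (γ * (1 - γ / T ^ 2 * A)) := by
    rw [← hkubo]; field_simp
  have hA' : A = T ^ 2 / γ - 2 * γ * T * E := by linarith
  rw [hDL, hA']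
  field_simp
  ring

/-- **The physical sign `D_L ≥ 0`** (`L ≥ 2`) along every steady family with response coefficients, under weak-NESS
uniqueness: `D_L` is `(L−1)(2γ³/T)` times a square integral. [cite: KunduDharNarayan2009, p. 3] -/
theorem response_nonneg
    {ω₂ lam β γ : ℝ} {μ : (N : ℕ) → ℝ → ℝ → Measure (PhaseSpace N)} {T : ℝ} {D : ℕ → ℝ}
    (hω : 0 < ω₂) (hl : 0 < lam) (hβ : 0 < β) (hγ : 0 < γ) (hT : 0 < T)
    (hU : ∀ (N : ℕ) (T_L T_R : ℝ), 0 < T_L → 0 < T_R → ∀ ρ ρ' : Measure (PhaseSpace N),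
        (pinnedChain ω₂ lam β γ).IsSteadyState N T_L T_R ρ →
        (pinnedChain ω₂ lam β γ).IsSteadyState N T_L T_R ρ' → ρ = ρ')
    (hμ : ∀ (N : ℕ) (T_L T_R : ℝ), 0 < T_L → 0 < T_R →
        (pinnedChain ω₂ lam β γ).IsSteadyState N T_L T_R (μ N T_L T_R))
    (hD : ∀ N : ℕ, Tendsto (fun δ : ℝ =>
        (pinnedChain ω₂ lam β γ).totalCurrent (μ N (T + δ / 2) (T - δ / 2)) / δ) (𝓝[≠] 0) (𝓝 (D N)))
    {L : ℕ} (hL2 : 2 ≤ L) : 0 ≤ D L := by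
  obtain ⟨g, hgC, hgL2, hg0, hgeq⟩ := stub_plainForwardField ω₂ lam β γ T hω hl hβ hγ hT L hL2
  rw [response_eq_dirichlet hω hl hβ hγ hT hU hμ hD hL2 hgC hgL2 hg0 hgeq]
  have hLnn : (0 : ℝ) ≤ (L : ℝ) - 1 := by
    have : (2 : ℝ) ≤ L := by exact_mod_cast hL2
    linarith
  have hEnn : 0 ≤ ∫ x, (partialP (⟨L - 1, by omega⟩ : Fin L) g x) ^ 2
      ∂((pinnedChain ω₂ lam β γ).gibbsMeasure L T) := integral_nonneg fun x => sq_nonneg _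
  positivity

/-! ## §2 The floor implies the crux -/

/-- **Transmission-gradient floor ⇒ `ConductanceLowerBound`** (constant `2γ³c/T`, threshold `max L₁ 2`): the composition of line
ForecastSensitivitySketch, all three fixed-`N` stubs now landed. [cite: ReyBellet2003, Rem. 4.4] -/
theorem conductanceLowerBound_of_floor
    (hF : ∀ (ω₂ lam β γ T : ℝ), 0 < ω₂ → 0 < lam → 0 < β → 0 < γ → 0 < T →
      ∃ c : ℝ, 0 < c ∧ ∃ L₁ : ℕ, ∀ (L : ℕ) (hL : 2 ≤ L), L₁ ≤ L → ∀ g : PhaseSpace L → ℝ, ContDiff ℝ 2 g →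
        MemLp g 2 ((pinnedChain ω₂ lam β γ).gibbsMeasure L T) →
        ∫ x, g x ∂((pinnedChain ω₂ lam β γ).gibbsMeasure L T) = 0 →
        (∀ x, (pinnedChain ω₂ lam β γ).generator L T T g x = -(kin L 0 x - T)) →
        c ≤ ((L : ℝ) - 1) *
          ∫ x, (partialP (⟨L - 1, by omega⟩ : Fin L) g x) ^ 2 ∂((pinnedChain ω₂ lam β γ).gibbsMeasure L T)) :
    ConductanceLowerBound := by
  intro ω₂ lam β γ hω hl hβ hγ huniq μ hμ T hT D hD
  obtain ⟨c, hc, L₁, hfloor⟩ := hF ω₂ lam β γ T hω hl hβ hγ hT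
  refine ⟨2 * γ ^ 3 * c / T, by positivity, max L₁ 2, fun L hL => ?_⟩
  have hL2 : 2 ≤ L := le_of_max_le_right hL
  have hL1 : L₁ ≤ L := le_of_max_le_left hL
  obtain ⟨g, hgC, hgL2, hg0, hgeq⟩ := stub_plainForwardField ω₂ lam β γ T hω hl hβ hγ hT L hL2
  rw [response_eq_dirichlet hω hl hβ hγ hT huniq hμ hD hL2 hgC hgL2 hg0 hgeq]
  have hfl := hfloor L hL2 hL1 g hgC hgL2 hg0 hgeq
  have h2 : 0 < 2 * γ ^ 3 / T := by positivity
  calc 2 * γ ^ 3 * c / T = 2 * γ ^ 3 / T * c := by ring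
    _ ≤ 2 * γ ^ 3 / T * (((L : ℝ) - 1) *
          ∫ x, (partialP (⟨L - 1, by omega⟩ : Fin L) g x) ^ 2 ∂((pinnedChain ω₂ lam β γ).gibbsMeasure L T)) :=
        mul_le_mul_of_nonneg_left hfl h2.le
    _ = _ := by ring

/-! ## §3 The crux implies the floor -/

/-- **`ConductanceLowerBound` ⇒ transmission-gradient floor** (constant `cT/(2γ³)`): run the crux along the CANONICAL steady-state
family (`pinnedChain_exists_isSteadyState`, junk `0` at non-positive temperatures), which is unique (`NessUnique_holds`) and has
response coefficients at every `N` (`FourierGreenKubo.finiteResponse_of_unique`); by `response_eq_dirichlet` the crux's bound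
`c ≤ D_L` is `c ≤ (L−1)(2γ³/T)‖∂_{p_{L−1}} g‖²` for EVERY left forward field `g`. [cite: ReyBellet2003, Rem. 4.4] -/
theorem floor_of_conductanceLowerBound (h : ConductanceLowerBound) :
    ∀ (ω₂ lam β γ T : ℝ), 0 < ω₂ → 0 < lam → 0 < β → 0 < γ → 0 < T →
      ∃ c : ℝ, 0 < c ∧ ∃ L₁ : ℕ, ∀ (L : ℕ) (hL : 2 ≤ L), L₁ ≤ L → ∀ g : PhaseSpace L → ℝ, ContDiff ℝ 2 g →
        MemLp g 2 ((pinnedChain ω₂ lam β γ).gibbsMeasure L T) →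
        ∫ x, g x ∂((pinnedChain ω₂ lam β γ).gibbsMeasure L T) = 0 →
        (∀ x, (pinnedChain ω₂ lam β γ).generator L T T g x = -(kin L 0 x - T)) →
        c ≤ ((L : ℝ) - 1) *
          ∫ x, (partialP (⟨L - 1, by omega⟩ : Fin L) g x) ^ 2 ∂((pinnedChain ω₂ lam β γ).gibbsMeasure L T) := by
  intro ω₂ lam β γ T hω hl hβ hγ hT
  -- the canonical steady-state family
  let μ : (N : ℕ) → ℝ → ℝ → Measure (PhaseSpace N) := fun N a b =>
    if hab : 0 < a ∧ 0 < b then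
      Classical.choose (pinnedChain_exists_isSteadyState hω hl hβ hγ N hab.1 hab.2)
    else 0
  have hμ : ∀ (N : ℕ) (T_L T_R : ℝ), 0 < T_L → 0 < T_R →
      (pinnedChain ω₂ lam β γ).IsSteadyState N T_L T_R (μ N T_L T_R) := by
    intro N T_L T_R hL hR
    show (pinnedChain ω₂ lam β γ).IsSteadyState N T_L T_R
      (if hab : 0 < T_L ∧ 0 < T_R then
        Classical.choose (pinnedChain_exists_isSteadyState hω hl hβ hγ N hab.1 hab.2) else 0)
    rw [dif_pos ⟨hL, hR⟩]
    exact Classical.choose_spec (pinnedChain_exists_isSteadyState hω hl hβ hγ N hL hR)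
  have hU : ∀ (N : ℕ) (T_L T_R : ℝ), 0 < T_L → 0 < T_R → ∀ ρ ρ' : Measure (PhaseSpace N),
      (pinnedChain ω₂ lam β γ).IsSteadyState N T_L T_R ρ →
      (pinnedChain ω₂ lam β γ).IsSteadyState N T_L T_R ρ' → ρ = ρ' :=
    NessUnique_holds ω₂ lam β γ hω hl hβ hγ
  -- its response coefficients exist
  have hDex := Summit.AtomisticToContinuum.FouriersLaw.Theorems.FourierGreenKubo.finiteResponse_of_unique
    ω₂ lam β γ hω hl hβ hγ hU μ hμ T hT
  choose D hD using hDex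
  obtain ⟨c, hc, N₁, hcD⟩ := h ω₂ lam β γ hω hl hβ hγ hU μ hμ T hT D hD
  refine ⟨c * T / (2 * γ ^ 3), by positivity, N₁, fun L hL2 hL1 g hgC hgL2 hg0 hgeq => ?_⟩
  have hDL := response_eq_dirichlet hω hl hβ hγ hT hU hμ hD hL2 hgC hgL2 hg0 hgeq
  have hcL : c ≤ D L := hcD L hL1
  rw [hDL] at hcL
  have h2 : 0 < 2 * γ ^ 3 / T := by positivity
  rw [div_le_iff₀ (by positivity : (0 : ℝ) < 2 * γ ^ 3)]
  have key : ((L : ℝ) - 1) * (2 * γ ^ 3 / T *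
      ∫ x, (partialP (⟨L - 1, by omega⟩ : Fin L) g x) ^ 2 ∂((pinnedChain ω₂ lam β γ).gibbsMeasure L T)) * T =
      ((L : ℝ) - 1) * (∫ x, (partialP (⟨L - 1, by omega⟩ : Fin L) g x) ^ 2
        ∂((pinnedChain ω₂ lam β γ).gibbsMeasure L T)) * (2 * γ ^ 3) := by
    field_simp
  calc c * T ≤ ((L : ℝ) - 1) * (2 * γ ^ 3 / T *
        ∫ x, (partialP (⟨L - 1, by omega⟩ : Fin L) g x) ^ 2 ∂((pinnedChain ω₂ lam β γ).gibbsMeasure L T)) * T :=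
        mul_le_mul_of_nonneg_right hcL hT.le
    _ = _ := key

/-! ## §4 The equivalence -/

/-- **`ConductanceLowerBound ↔ TRANSMISSION-GRADIENT FLOOR.`**  The crux (an `N`-uniform lower bound on the linear-response
conductance of the NON-EQUILIBRIUM steady states) is equivalent to a pure EQUILIBRIUM statement: for all parameters `> 0` and
`T > 0` there are `c > 0`, `L₁` such that for every `L ≥ L₁` (`L ≥ 2`) every classical mean-zero `C² ∩ L²(μ_T)` solution `g` of
`L_{T,T} g = −(p_0² − T)` has `(L−1)·∫ (∂_{p_{L−1}} g)² dμ_T ≥ c`.  (The bet `stub_transmissionGradientFloor` of line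
ForecastSensitivitySketch is therefore exactly crux-strength — neither stronger nor weaker.) [cite: ReyBellet2003, Rem. 4.4]
[cite: KunduDharNarayan2009, p. 3] -/
theorem conductanceLowerBound_iff_floor :
    Summit.AtomisticToContinuum.FouriersLaw.Theses.JunctionLocality.ConductanceLowerBound ↔
    ∀ (ω₂ lam β γ T : ℝ), 0 < ω₂ → 0 < lam → 0 < β → 0 < γ → 0 < T →
      ∃ c : ℝ, 0 < c ∧ ∃ L₁ : ℕ, ∀ (L : ℕ) (hL : 2 ≤ L), L₁ ≤ L → ∀ g : PhaseSpace L → ℝ, ContDiff ℝ 2 g →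
        MemLp g 2 ((pinnedChain ω₂ lam β γ).gibbsMeasure L T) →
        ∫ x, g x ∂((pinnedChain ω₂ lam β γ).gibbsMeasure L T) = 0 →
        (∀ x, (pinnedChain ω₂ lam β γ).generator L T T g x = -(kin L 0 x - T)) →
        c ≤ ((L : ℝ) - 1) *
          ∫ x, (partialP (⟨L - 1, by omega⟩ : Fin L) g x) ^ 2 ∂((pinnedChain ω₂ lam β γ).gibbsMeasure L T) :=
  ⟨floor_of_conductanceLowerBound, conductanceLowerBound_of_floor⟩

end Summit.AtomisticToContinuum.FouriersLaw.Cruxes.ConductanceLowerBound.ForecastSensitivity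

end
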